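import Summits.ResolutionOfSingularities.ResolutionOfSingularities.Theorems.WeightedInvariantIota3EpsEssSmooth
import Literature.AlgebraicGeometry.Resolution.AdicCompletionRegular
import HarnessLib

/-!
# (c10) for the letter `ε`: the permissibility of the equimultiple locus is unchanged along the TORUS FACTOR `S → S[X]_𝔮`
# (`𝔮 ∩ S = 𝔪_S`) — door `HypersurfaceCentreConstruction` (stmt-ResolutionOfSingularities-19897), route `WeightedInvariant`,
# rung P3, ORDER (o32-ι-a″) second half «then (c10ε)»

[OURS · L1 W4.3 · cell `res-hironaka`, HUMAN RULING D-0089] Helper file `--supports stmt-ResolutionOfSingularities-19897`,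
res-type-013 on res-L1-w43-plan-1's IOTA3-DESIGN v1 §2.2 lemma obligation (c10ε|ν) (ORDER (o32-ι-a″) «… then (c10ε)», DEALS gen 10 #8 (2)).
Def-free; pure commutative algebra over the tree; no named facts.  NOT a statement of the manuscript under review (Hironaka 2017,
[claim: Hironaka2017, status: under-review]); nothing here claims anything about resolution of singularities; AI work, weaker than
expert review.

THE POINT.  For a regular local ring `S` and a prime `𝔮 ⊂ S[X]` over `𝔪_S`, the structure map `S → S[X]_𝔮` is a LOCAL homomorphism of
REGULAR local rings which is FORMALLY SMOOTH (polynomial ring, then localisation) and ESSENTIALLY OF FINITE TYPE — i.e. it is one of the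
maps of the clause (c11).  So (c10ε) is a COROLLARY of (c11ε) (`Iota3.iotaEps_essSmooth_eq`, p528660), and in fact an EQUALITY:

* `iotaEps_torusFactor_eq` — `iotaEps (S[X]_𝔮) f = iotaEps S f`;
* `iotaEps_torusFactorMonotoneOn : IotaTorusFactorMonotoneOn iotaOrd iotaEps` (the stratum-relative clause res-type-073's transfer kit
  consumes) and the plain `iotaEps_torusFactorMonotone : IotaTorusFactorMonotone iotaEps`;
* `iotaOrdEps_torusFactor_eq`, **`iotaOrdEps_torusFactorMonotone : IotaTorusFactorMonotone iotaOrdEps`** — (c10) for the pair `(ν ; ε)`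
  (res-type-073's `iotaOrd_torusFactor_eq` (p502169) for `ν`, `iotaLex_iotaOrd_torusFactorMonotone` (p504861) for the transfer).

## References

* H. Matsumura, *Commutative Ring Theory*, CUP 1986, Thm. 19.5 (regularity of `R[X]`), Thm. 23.7. [Matsumura1987]
* res-L1-w43-plan-1, `IOTA3-DESIGN.md` v1 §2.2 (c10ε|ν) (OURS, AI planning).
-/

noncomputable section

set_option linter.dupNamespace false -- mandated namespace `Summit.<Summit>.<Problem>` of this single-conjunct summit

open IsLocalRing Polynomial Literature.AlgebraicGeometry.Resolution

namespace Summit.ResolutionOfSingularities.ResolutionOfSingularities.Cruxes.HypersurfaceCentreConstruction.LocalEngine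

namespace Iota3

section Torus

variable (S : Type) [CommRing S] [IsRegularLocalRing S] (𝔮 : Ideal S[X]) [𝔮.IsPrime]
  (h𝔮 : 𝔮.comap (Polynomial.C : S →+* S[X]) = maximalIdeal S)

/-- `S[X]_𝔮` is a regular local ring (Serre + Hilbert: `S` regular local ⇒ `S` regular ring ⇒ `S[X]` regular ring). [cite: Matsumura1987, Thm. 19.5] -/
theorem isRegularLocalRing_localization_polynomial : IsRegularLocalRing (Localization.AtPrime 𝔮) := by
  haveI : IsRegularRing S := isRegularRing_of_isRegularLocalRing S
  infer_instance

include h𝔮 in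
/-- The structure map `S → S[X]_𝔮` is LOCAL when `𝔮` lies over `𝔪_S`. [folklore] -/
theorem isLocalHom_algebraMap_localization_polynomial : IsLocalHom (algebraMap S (Localization.AtPrime 𝔮)) := by
  refine ⟨fun x hx => ?_⟩
  by_contra hnu
  have hxm : x ∈ maximalIdeal S := (IsLocalRing.mem_maximalIdeal x).mpr (mem_nonunits_iff.mpr hnu)
  have hCx : Polynomial.C x ∈ 𝔮 := by
    rw [← h𝔮] at hxm
    exact Ideal.mem_comap.mp hxm
  have hmem : algebraMap S (Localization.AtPrime 𝔮) x ∈ maximalIdeal (Localization.AtPrime 𝔮) := by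
    rw [IsScalarTower.algebraMap_apply S S[X] (Localization.AtPrime 𝔮), Polynomial.algebraMap_eq,
      ← Localization.AtPrime.map_eq_maximalIdeal]
    exact Ideal.mem_map_of_mem _ hCx
  exact (mem_nonunits_iff.mp ((IsLocalRing.mem_maximalIdeal _).mp hmem)) hx

omit [IsRegularLocalRing S] in
/-- `S → S[X]_𝔮` is formally smooth. [folklore] -/
theorem formallySmooth_localization_polynomial : Algebra.FormallySmooth S (Localization.AtPrime 𝔮) :=
  haveI : Algebra.FormallySmooth S[X] (Localization.AtPrime 𝔮) := Algebra.FormallySmooth.of_isLocalization 𝔮.primeCompl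
  Algebra.FormallySmooth.comp S S[X] (Localization.AtPrime 𝔮)

omit [IsRegularLocalRing S] in
/-- `S → S[X]_𝔮` is essentially of finite type. [folklore] -/
theorem essFiniteType_localization_polynomial : Algebra.EssFiniteType S (Localization.AtPrime 𝔮) :=
  haveI : Algebra.EssFiniteType S[X] (Localization.AtPrime 𝔮) := Algebra.EssFiniteType.of_isLocalization _ 𝔮.primeCompl
  Algebra.EssFiniteType.comp S S[X] (Localization.AtPrime 𝔮)

include h𝔮 in
/-- **(c10ε) AS AN EQUALITY**: `iotaEps (S[X]_𝔮) f = iotaEps S f` for every prime `𝔮 ⊂ S[X]` over `𝔪_S` — the torus-factor map is one of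
the essentially smooth local homomorphisms of (c11), so `iotaEps_essSmooth_eq` (p528660) applies. [OURS · L1 W4.3, kernel] -/
theorem iotaEps_torusFactor_eq (f : S) :
    iotaEps (Localization.AtPrime 𝔮) (algebraMap S[X] (Localization.AtPrime 𝔮) (Polynomial.C f)) = iotaEps S f := by
  haveI := isRegularLocalRing_localization_polynomial S 𝔮
  haveI := isLocalHom_algebraMap_localization_polynomial S 𝔮 h𝔮
  haveI := formallySmooth_localization_polynomial S 𝔮
  haveI := essFiniteType_localization_polynomial S 𝔮
  have h : algebraMap S[X] (Localization.AtPrime 𝔮) (Polynomial.C f) = algebraMap S (Localization.AtPrime 𝔮) f := by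
    rw [IsScalarTower.algebraMap_apply S S[X] (Localization.AtPrime 𝔮), Polynomial.algebraMap_eq]
  rw [h]
  exact iotaEps_essSmooth_eq S (Localization.AtPrime 𝔮) f

include h𝔮 in
/-- (c10) for the pair as an EQUALITY: `iotaOrdEps (S[X]_𝔮) f = iotaOrdEps S f`. [OURS · L1 W4.3, kernel] -/
theorem iotaOrdEps_torusFactor_eq (f : S) :
    iotaOrdEps (Localization.AtPrime 𝔮) (algebraMap S[X] (Localization.AtPrime 𝔮) (Polynomial.C f)) = iotaOrdEps S f := by
  rw [iotaOrdEps_apply, iotaOrdEps_apply, iotaOrd_torusFactor_eq S f 𝔮 h𝔮, iotaEps_torusFactor_eq S 𝔮 h𝔮 f]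

end Torus

/-- **(c10ε|ν)**: `IotaTorusFactorMonotoneOn iotaOrd iotaEps` (the stratum-relative clause of res-type-073's transfer kit; here it holds
unconditionally, with equality). [OURS · L1 W4.3, kernel] -/
theorem iotaEps_torusFactorMonotoneOn : IotaTorusFactorMonotoneOn iotaOrd iotaEps := by
  intro S _ _ f 𝔮 _ h𝔮 _
  exact (iotaEps_torusFactor_eq S 𝔮 h𝔮 f).le

/-- **(c10) for `ε`**: `IotaTorusFactorMonotone iotaEps`. [OURS · L1 W4.3, kernel] -/
theorem iotaEps_torusFactorMonotone : IotaTorusFactorMonotone iotaEps := by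
  intro S _ _ f 𝔮 _ h𝔮
  exact (iotaEps_torusFactor_eq S 𝔮 h𝔮 f).le

/-- **(c10) for the pair `(ν ; ε)`**: `IotaTorusFactorMonotone iotaOrdEps`. [OURS · L1 W4.3, kernel] -/
theorem iotaOrdEps_torusFactorMonotone : IotaTorusFactorMonotone iotaOrdEps :=
  iotaLex_iotaOrd_torusFactorMonotone iotaEps_boundedBy_omega0 iotaEps_torusFactorMonotoneOn

end Iota3

end Summit.ResolutionOfSingularities.ResolutionOfSingularities.Cruxes.HypersurfaceCentreConstruction.LocalEngine

end
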